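import Mathlib
import Summits.QuantumAdvantage.QuantumAdvantage.Theorems.MobiusLadderQuadraticDigitPhasesStubOpSem

/-!
# `QuadraticDigitPhases` (stmt-QuantumAdvantage-1391), line `Sketch` — helper toward `stub_tameCore` / `stub_rankCore`

ABSTRACT OPERATOR SEMANTICS of the reduced carry automaton.  The registered core stubs `stub_tameCore`,
`stub_rankCore` are stated for an ABSTRACT coefficient pattern `a : ℕ → ℕ → ZMod 2`, linear data
`l : ℕ → ZMod 2` and an ABSTRACT family `μ` obeying the one-step transfer recursion from the point mass.
This file identifies every such `μ` (below the level `N ≤ n`) with the explicit fibre sums.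

Fix multipliers `p, q ≥ 1`.  At level `M` a residue `T < 2^M` has the reduced state
`σ_M(T) = (⌊pT/2^M⌋, ⌊qT/2^M⌋, πᵖ_M(T), π^q_M(T))` (two carries and two pending linear forms
`π_M(T) j = Σ_{i<M} a i j · yᵢ`, `j ≥ M`, in the digits `yᵢ` of `pT`, resp. `qT`) and the sign `(-1)^{Φ_M(T)}`,
`Φ_M` = pairs `i<j<M` (weights `a i j`) plus linear terms `i<M` (weights `l i`) on both sides;
`fib M x π π'` is the sum of the signs over the fibre `σ_M⁻¹(x, π, π')`.

* `fibA_spec`: INIT (`M = 0`: only `T = 0`, state `((0,0),0,0)`, sign `+1`) and STEP (the one-step transfer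
  recursion for `N' < n`), proved exactly as the concrete `stub_opSem` (same abstract `transfer`,
  `carry_succ`, `bit_low`, `bit_succ`, `pend_succ`, `sign_succ` of that file, now with `C i j = a i j`,
  `D j = a N' j`, `Q = a`, `L = l`, so the two coefficient-compatibility side conditions are `rfl`).
* `eq_fibA_of_recursion`: UNIQUENESS — any `μ` with the same start and the same one-step rule below
  `N ≤ n` equals `fib` up to level `N` (induction on the level).
-/

set_option linter.dupNamespace false -- D-0017: single-problem summit ⇒ `QuantumAdvantage.QuantumAdvantage` by design

namespace Summit.QuantumAdvantage.QuantumAdvantage.Theorems.MobiusLadderQuadraticDigitPhasesRankCoreFibre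

open Finset
open Summit.QuantumAdvantage.QuantumAdvantage.Theorems.MobiusLadderQuadraticDigitPhasesStubOpSem
  (transfer sum_range_double carry_succ bit_low bit_succ pend_succ sign_succ)

/-- ABSTRACT OPERATOR SEMANTICS (helper toward the registered stubs `stub_tameCore` / `stub_rankCore` of crux
stmt-QuantumAdvantage-1391, line Sketch): for an abstract pattern `a` and linear data `l`, the fibre sums of the signed
reduced-state measure start at the point mass and satisfy the one-step transfer recursion (for levels `N' < n`). -/
theorem fibA_spec :
    ∀ (p q n : ℕ) (a : ℕ → ℕ → ZMod 2) (l : ℕ → ZMod 2) (fib : ℕ → ℕ × ℕ → (Fin n → ZMod 2) → (Fin n → ZMod 2) → ℝ),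
      (∀ (M : ℕ) (x : ℕ × ℕ) (π π' : Fin n → ZMod 2), fib M x π π' = (∑ T ∈ (Finset.range (2 ^ M)).filter (fun T => (p * T / 2 ^ M = x.1 ∧ q * T / 2 ^ M = x.2 ∧ (fun j : Fin n => if M ≤ (j : ℕ) then ∑ i ∈ Finset.range M, a i (j : ℕ) * (if Nat.testBit (p * T) i then (1 : ZMod 2) else 0) else 0) = π ∧ (fun j : Fin n => if M ≤ (j : ℕ) then ∑ i ∈ Finset.range M, a i (j : ℕ) * (if Nat.testBit (q * T) i then (1 : ZMod 2) else 0) else 0) = π')), (if (((∑ i ∈ Finset.range M, ∑ j ∈ Finset.range M, (if i < j then a i j * (if Nat.testBit (p * T) i then (1 : ZMod 2) else 0) * (if Nat.testBit (p * T) j then (1 : ZMod 2) else 0) else 0)) + ∑ i ∈ Finset.range M, l i * (if Nat.testBit (p * T) i then (1 : ZMod 2) else 0)) + ((∑ i ∈ Finset.range M, ∑ j ∈ Finset.range M, (if i < j then a i j * (if Nat.testBit (q * T) i then (1 : ZMod 2) else 0) * (if Nat.testBit (q * T) j then (1 : ZMod 2) else 0) else 0)) + ∑ i ∈ Finset.range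 M, l i * (if Nat.testBit (q * T) i then (1 : ZMod 2) else 0))) = 1 then (-1 : ℝ) else 1))) → 0 < p → 0 < q →
      (∀ (x : ℕ × ℕ) (π π' : Fin n → ZMod 2), fib 0 x π π' = if x = (0, 0) ∧ π = 0 ∧ π' = 0 then 1 else 0) ∧
      (∀ N', N' < n → ∀ (x' : ℕ × ℕ) (ρ ρ' : Fin n → ZMod 2), fib (N' + 1) x' ρ ρ' =
          ∑ x ∈ Finset.range p ×ˢ Finset.range q, ∑ π : Fin n → ZMod 2, ∑ π' : Fin n → ZMod 2, ∑ t ∈ Finset.range 2,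
            (if ((p * t + x.1) / 2 = x'.1 ∧ (q * t + x.2) / 2 = x'.2 ∧ (fun j : Fin n => if N' + 1 ≤ (j : ℕ) then π j + a N' (j : ℕ) * (if (p * t + x.1) % 2 = 1 then (1 : ZMod 2) else 0) else 0) = ρ ∧ (fun j : Fin n => if N' + 1 ≤ (j : ℕ) then π' j + a N' (j : ℕ) * (if (q * t + x.2) % 2 = 1 then (1 : ZMod 2) else 0) else 0) = ρ') then (if (if (p * t + x.1) % 2 = 1 then (1 : ZMod 2) else 0) * ((if h : N' < n then π ⟨N', h⟩ else 0) + l N') + (if (q * t + x.2) % 2 = 1 then (1 : ZMod 2) else 0) * ((if h : N' < n then π' ⟨N', h⟩ else 0) + l N') = 1 then (-1 : ℝ) else 1) * fib N' x π π' else 0)) := by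
  intro p q n a l fib hfib hp hq
  refine ⟨fun x π π' => ?_, fun N' hN' x' ρ ρ' => ?_⟩
  · rw [hfib]
    simp only [pow_zero, Finset.range_one, Finset.sum_range_zero, add_zero, Nat.div_one, zero_le,
      if_true]
    rw [Finset.sum_filter, Finset.sum_singleton, mul_zero, mul_zero,
      if_neg (show ¬ ((0 : ZMod 2) = 1) by decide)]
    by_cases h : x = (0, 0) ∧ π = 0 ∧ π' = 0
    · rw [if_pos h, if_pos]
      obtain ⟨rfl, rfl, rfl⟩ := h
      exact ⟨rfl, rfl, rfl, rfl⟩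
    · rw [if_neg h, if_neg]
      rintro ⟨h1, h2, h3, h4⟩
      exact h ⟨Prod.ext h1.symm h2.symm, h3.symm, h4.symm⟩
  · rw [hfib]
    refine transfer (range (2 ^ (N' + 1))) (range (2 ^ N')) (range p ×ˢ range q)
      (fun t T => t * 2 ^ N' + T) (hfib N') (sum_range_double N') ?_ ?_ x' ρ ρ'
    · intro T hT
      rw [Finset.mem_range] at hT
      refine Finset.mem_product.mpr ⟨Finset.mem_range.mpr ?_, Finset.mem_range.mpr ?_⟩
      · exact Nat.div_lt_of_lt_mul (by
          calc p * T < p * 2 ^ N' := mul_lt_mul_of_pos_left hT hp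
            _ = 2 ^ N' * p := Nat.mul_comm _ _)
      · exact Nat.div_lt_of_lt_mul (by
          calc q * T < q * 2 ^ N' := mul_lt_mul_of_pos_left hT hq
            _ = 2 ^ N' * q := Nat.mul_comm _ _)
    · intro t T
      refine ⟨carry_succ p N' t T, carry_succ q N' t T, ?_, ?_, ?_⟩
      · exact pend_succ N' (fun i (j : Fin n) => a i (j : ℕ)) _ _ _ _
          (fun i hi => bit_low p N' t T i hi) (bit_succ p N' t T) (fun _ => rfl)
      · exact pend_succ N' (fun i (j : Fin n) => a i (j : ℕ)) _ _ _ _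
          (fun i hi => bit_low q N' t T i hi) (bit_succ q N' t T) (fun _ => rfl)
      · exact sign_succ N' hN' a l (fun i (j : Fin n) => a i (j : ℕ)) _ _ _ _ _ _ (fun _ => rfl)
          (fun i hi => bit_low p N' t T i hi) (bit_succ p N' t T)
          (fun i hi => bit_low q N' t T i hi) (bit_succ q N' t T)

/-- UNIQUENESS OF THE SOLUTION OF THE TRANSFER RECURSION (helper toward the registered stubs `stub_tameCore` /
`stub_rankCore` of crux stmt-QuantumAdvantage-1391, line Sketch): any family `μ` that starts at the point mass and obeys
the one-step transfer recursion below the level `N ≤ n` coincides, up to level `N`, with the explicit fibre sums `fib` of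
`fibA_spec` (induction on the level: both satisfy the same start and the same one-step rule). -/
theorem eq_fibA_of_recursion :
    ∀ (p q n N : ℕ) (a : ℕ → ℕ → ZMod 2) (l : ℕ → ZMod 2) (fib μ : ℕ → ℕ × ℕ → (Fin n → ZMod 2) → (Fin n → ZMod 2) → ℝ),
      (∀ (M : ℕ) (x : ℕ × ℕ) (π π' : Fin n → ZMod 2), fib M x π π' = (∑ T ∈ (Finset.range (2 ^ M)).filter (fun T => (p * T / 2 ^ M = x.1 ∧ q * T / 2 ^ M = x.2 ∧ (fun j : Fin n => if M ≤ (j : ℕ) then ∑ i ∈ Finset.range M, a i (j : ℕ) * (if Nat.testBit (p * T) i then (1 : ZMod 2) else 0) else 0) = π ∧ (fun j : Fin n => if M ≤ (j : ℕ) then ∑ i ∈ Finset.range M, a i (j : ℕ) * (if Nat.testBit (q * T) i then (1 : ZMod 2) else 0) else 0) = π')), (if (((∑ i ∈ Finset.range M, ∑ j ∈ Finset.range M, (if i < j then a i j * (if Nat.testBit (p * T) i then (1 : ZMod 2) else 0) * (if Nat.testBit (p * T) j then (1 : ZMod 2) else 0) else 0)) + ∑ i ∈ Finset.range M, l i * (if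 Nat.testBit (p * T) i then (1 : ZMod 2) else 0)) + ((∑ i ∈ Finset.range M, ∑ j ∈ Finset.range M, (if i < j then a i j * (if Nat.testBit (q * T) i then (1 : ZMod 2) else 0) * (if Nat.testBit (q * T) j then (1 : ZMod 2) else 0) else 0)) + ∑ i ∈ Finset.range M, l i * (if Nat.testBit (q * T) i then (1 : ZMod 2) else 0))) = 1 then (-1 : ℝ) else 1))) → 0 < p → 0 < q → N ≤ n →
      (∀ x π π', μ 0 x π π' = if x = (0, 0) ∧ π = 0 ∧ π' = 0 then 1 else 0) →
      (∀ N', N' < N → ∀ x' ρ ρ', μ (N' + 1) x' ρ ρ' =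
          ∑ x ∈ Finset.range p ×ˢ Finset.range q, ∑ π : Fin n → ZMod 2, ∑ π' : Fin n → ZMod 2, ∑ t ∈ Finset.range 2,
            (if ((p * t + x.1) / 2 = x'.1 ∧ (q * t + x.2) / 2 = x'.2 ∧ (fun j : Fin n => if N' + 1 ≤ (j : ℕ) then π j + a N' (j : ℕ) * (if (p * t + x.1) % 2 = 1 then (1 : ZMod 2) else 0) else 0) = ρ ∧ (fun j : Fin n => if N' + 1 ≤ (j : ℕ) then π' j + a N' (j : ℕ) * (if (q * t + x.2) % 2 = 1 then (1 : ZMod 2) else 0) else 0) = ρ') then (if (if (p * t + x.1) % 2 = 1 then (1 : ZMod 2) else 0) * ((if h : N' < n then π ⟨N', h⟩ else 0) + l N') + (if (q * t + x.2) % 2 = 1 then (1 : ZMod 2) else 0) * ((if h : N' < n then π' ⟨N', h⟩ else 0) + l N') = 1 then (-1 : ℝ) else 1) * μ N' x π π' else 0)) →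
      ∀ N', N' ≤ N → ∀ x π π', μ N' x π π' = fib N' x π π' := by
  intro p q n N a l fib μ hfib hp hq hNn h0 hrec
  obtain ⟨hf0, hfs⟩ := fibA_spec p q n a l fib hfib hp hq
  intro N'
  induction N' with
  | zero =>
    intro _ x π π'
    rw [h0, hf0]
  | succ N' ih =>
    intro hN' x' ρ ρ'
    have ih' : ∀ x π π', μ N' x π π' = fib N' x π π' := ih (Nat.le_of_succ_le hN')
    rw [hrec N' (Nat.lt_of_succ_le hN'),
      hfs N' (Nat.lt_of_lt_of_le (Nat.lt_of_succ_le hN') hNn)]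
    simp only [ih']

end Summit.QuantumAdvantage.QuantumAdvantage.Theorems.MobiusLadderQuadraticDigitPhasesRankCoreFibre
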